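import Literature.Geometry.Kaehler.RiemannSurfaceRationalCharacterFormula
import HarnessLib

/-!
# The contribution of a fixed point to the Chevalley–Weil formula:
# `Σ_{h ∈ G_P, h ≠ 1} a_P(h) χ_V(h)/(1 − a_P(h)) = Σ_α α·N_{P,α} − dim V·(m − 1)/2`
# (Kopeliovich–Zemel, proof of Theorem 6.6; Chevalley–Weil 1934)

Layer `Literature/Geometry/Kaehler`, sequel of `RiemannSurfaceRationalCharacterFormula` (Rojas' formula for
`χ + χ̄` via Lefschetz) on the way to the CHEVALLEY–WEIL FORMULA for the character `χ` of `Aut M` on `𝓗¹(M)`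
itself (sequel `RiemannSurfaceChevalleyWeilFormula`), which needs the full Eichler trace formula
`tr h = 1 + Σ_{P ∈ Fix h} a_P(h⁻¹)/(1 − a_P(h⁻¹))` (`RiemannSurfaceEichlerTraceFormula`) instead of its real part.
Summed against the character `χ_V` of a representation `(V, ρ)` of `G ≤ Aut M` and reorganised over the points
`P` with non-trivial (cyclic, `RiemannSurfaceAutomorphismRotationGroup`) stabilizer `G_P` of order `m`, the
fixed-point terms contribute, for each such `P`, the quantity computed in this file:

  `Σ_{h ∈ G_P, h ≠ 1} (a_P(h)/(1 − a_P(h)))·χ_V(h) = Σ_{α=0}^{m−1} α·N_{P,α} − dim V·(m − 1)/2`,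

where `a_P : G_P → ℂ^×` is the rotation character (`stabDeriv`, injective with image the `m`-th roots of unity)
and `N_{P,α} = dim Eig(ρ(g), a_P(g)^α)` for a generator `g` of `G_P` — intrinsically the dimension of the
`a_P^α`-isotypic part of `V|_{G_P}` (`eigenspace_eq_iInf_eigenspace_stabDeriv_pow`). S. Kopeliovich, S. Zemel,
*On spaces associated with invariant divisors on Galois covers of Riemann surfaces and their applications*,
Israel J. Math. 234 (2019), proof of Theorem 6.6, as printed (arXiv copy p. 27–28; there `o(C) = m`, `σ` a
generator of the stabilizer, `N^ρ_{C,α} = dim Eig(ρ(σ), ζ_{o(C)}^α)`, and `q = 1`, `Γ = 0` is our case):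

> For any conjugacy class `C`, the element `ρ(σ)` for `σ ∈ C` decomposes the representation space of `ρ` into
> eigenspaces of eigenvalues `ζ_{o(C)}^α` for `α ∈ ℤ/o(C)ℤ`. The dimensions of these spaces are independent of
> the choice of `σ ∈ C`, and they are denoted by `N^ρ_{C,α}` […] The sum `Σ_{α} N^ρ_{C,α}` is therefore the full
> dimension `d_ρ` of the representation space of `ρ`. […] Now, the elements `τ` over which we sum are `τ = σ^β`
> for `0 ≠ β ∈ ℤ/o(C)ℤ` […] As for the multiplier `χ(τ⁻¹) = χ(σ^{−β})`, we recall that the eigenspaces of `ρ(σ)`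
> have eigenvalues `ζ_{o(C)}^α` with `α ∈ ℤ/o(C)ℤ`, with respective dimensions `N^ρ_{C,α}`. Hence this multiplier
> is `Σ_α N^ρ_{C,α} ζ_{o(C)}^{−αβ}`, and the total contribution from `P` is
> `Σ_{l=0}^{o(C)−1} (l/o(C)) Σ_α N^ρ_{C,α} Σ_{0≠β} ζ_{o(C)}^{β(q−1−l−α)}`. In order to evaluate the latter sum, we
> add and subtract all the terms with `β = 0`. This yields the same sum without the restriction `β ≠ 0`, minus
> `Σ_l (l/o(C)) Σ_α N^ρ_{C,α}·1`. The latter sum is the product of `(o(C) − 1)/2` from the sum over `l` and the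
> total dimension `d_ρ` of `ρ`. On the other hand, […] taking the inner sum over `β ∈ ℤ/o(C)ℤ` yields `o(C)` if
> `o(C) | q−1−l−α` and vanishes otherwise. The surviving element `l` is clearly `o(C)·{(q−1−α)/o(C)}` […]

Here, with the tree's normalisation of the Eichler trace formula (Farkas–Kra V.2.9: `tr T = 1 + Σ_P
a_P(T⁻¹)/(1 − a_P(T⁻¹))`, `a_P = stabDeriv P`), the root-of-unity bookkeeping is done directly on
`Σ_{k=1}^{m−1} ε^{k(α+1)}/(1 − ε^k) = α − (m − 1)/2` (`ε = a_P(g)` primitive), which is the `q = 1` instance of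
the displayed evaluation multiplied by `o(C) = m`.

## What is formalized (everything proved; no definitions, no named facts, no instances)

* §1 roots of unity (`ε` a primitive `m`-th root): `sum_range_pow_mul_eq_ite` (`Σ_{k<m} ε^{kβ} = m·[m ∣ β]`),
  `sum_Ico_pow_mul_eq_neg_one`, `pow_ne_one_of_mem_Ico`, **`sum_Ico_one_div_one_sub_pow`**
  (`Σ_{k=1}^{m−1} 1/(1 − ε^k) = (m − 1)/2`), **`sum_Ico_pow_mul_succ_div_one_sub_pow`**
  (`Σ_{k=1}^{m−1} ε^{k(α+1)}/(1 − ε^k) = α − (m − 1)/2`, `α < m`), `nthRootsFinset_eq_image_pow_of_isPrimitiveRoot`;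
* §2 endomorphisms `f` with `f^m = 1` of a finite-dimensional complex space: `eigenspace_eq_bot_of_pow_eq_one`,
  `trace_pow_restrict_eigenspace`, **`trace_pow_eq_sum_pow_mul_finrank_eigenspace`**
  (`tr f^k = Σ_{α<m} ε^{kα} dim E_{ε^α}(f)`), `sum_finrank_eigenspace_eq_finrank` (`Σ_α dim E_{ε^α} = dim V`);
* §3 for `G ≤ Aut M` (`Aut M` finite), a point `P`, a generator `g` of `G_P` and a representation `(V, ρ)` of `G`:
  `isPrimitiveRoot_stabDeriv_of_forall_mem_zpowers`, `stabDeriv_pow`, `map_pow_card_stabilizer_eq_one`,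
  `orderOf_eq_card_stabilizer`, `filter_smul_eq_erase_one_eq_image_pow` (`G_P ∖ {1} = {g, …, g^{m−1}}`),
  **`sum_Ico_stabDeriv_pow_div_mul_trace_eq`** and **`sum_stabilizer_stabDeriv_div_mul_trace_eq`** (the displayed
  contribution of `P`), **`eigenspace_eq_iInf_eigenspace_stabDeriv_pow`** (`N_{P,α}` is intrinsic).

## References

* S. Kopeliovich, S. Zemel, *On spaces associated with invariant divisors on Galois covers of Riemann surfaces and
  their applications*, Israel J. Math. 234 (2019), 393–450, Theorem 6.6 and its proof (arXiv:1609.02296, pp. 27–28).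
  [KopeliovichZemel2019]
* C. Chevalley, A. Weil, *Über das Verhalten der Integrale 1. Gattung bei Automorphismen des Funktionenkörpers*,
  Abh. Math. Sem. Hamburg 10 (1934), 358–361. [ChevalleyWeil1934Integrale]
* H. M. Farkas, I. Kra, *Riemann Surfaces*, GTM 71, 2nd ed. (1992), III.7.7, V.2.3–V.2.4, V.2.7, V.2.9. [FarkasKra1992]
* R. Miranda, *Algebraic Curves and Riemann Surfaces*, GSM 5 (1995), Chapter III Proposition 3.1, Corollary 3.5.
  [Miranda1995]
-/

noncomputable section

open scoped Manifold ContDiff Topology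
open Set Filter Function Complex MulAction Module

namespace Literature.Geometry.Kaehler

namespace RiemannSurface

/-! ### §1 Sums over the non-trivial `m`-th roots of unity -/

section Roots

variable {m : ℕ} {ε : ℂ}

/-- **`Σ_{k=0}^{m−1} ε^{kβ} = m` if `m ∣ β` and `= 0` otherwise** (`ε` a primitive `m`-th root of unity; «taking
the inner sum over `β ∈ ℤ/o(C)ℤ` yields `o(C)` if `o(C) | q−1−l−α` and vanishes otherwise»).
[cite: KopeliovichZemel2019, Theorem 6.6 (proof)] -/
theorem sum_range_pow_mul_eq_ite (hε : IsPrimitiveRoot ε m) (β : ℕ) :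
    ∑ k ∈ Finset.range m, ε ^ (k * β) = if m ∣ β then (m : ℂ) else 0 := by
  have hpow : ∀ k : ℕ, ε ^ (k * β) = (ε ^ β) ^ k := fun k ↦ by rw [mul_comm, pow_mul]
  simp_rw [hpow]
  split_ifs with hdvd
  · rw [(hε.pow_eq_one_iff_dvd β).2 hdvd]
    simp
  · have hne : ε ^ β ≠ 1 := fun h ↦ hdvd ((hε.pow_eq_one_iff_dvd β).1 h)
    rw [geom_sum_eq hne, ← pow_mul, mul_comm, pow_mul, hε.pow_eq_one, one_pow, sub_self, zero_div]

/-- `Σ_{k=1}^{m−1} ε^{kβ} = −1` when `m ∤ β` (the previous sum without its `k = 0` term).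
[cite: KopeliovichZemel2019, Theorem 6.6 (proof)] [cite: FarkasKra1992, V.2.7 («`Σ_{j=1}^{n−1} εʲ = −1`»)] -/
theorem sum_Ico_pow_mul_eq_neg_one (hε : IsPrimitiveRoot ε m) (hm : 0 < m) {β : ℕ} (hβ : ¬ m ∣ β) :
    ∑ k ∈ Finset.Ico 1 m, ε ^ (k * β) = -1 := by
  have h := sum_range_pow_mul_eq_ite hε β
  rw [if_neg hβ, Finset.range_eq_Ico, Finset.sum_eq_sum_Ico_succ_bot hm, zero_mul, pow_zero] at h
  linear_combination h

/-- For `1 ≤ k < m` the root `ε^k` is not `1`. [cite: FarkasKra1992, V.2.7] -/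
theorem pow_ne_one_of_mem_Ico (hε : IsPrimitiveRoot ε m) {k : ℕ} (hk : k ∈ Finset.Ico 1 m) : ε ^ k ≠ 1 := by
  rw [Finset.mem_Ico] at hk
  exact hε.pow_ne_one_of_pos_of_lt (by omega) hk.2

/-- **`Σ_{k=1}^{m−1} 1/(1 − ε^k) = (m − 1)/2`** (pair `k` with `m − k`: `1/(1 − θ) + 1/(1 − θ⁻¹) = 1`; «the latter
sum is the product of `(o(C) − 1)/2` from the sum over `l` …»). [cite: KopeliovichZemel2019, Theorem 6.6 (proof)]
[cite: FarkasKra1992, V.2.9 (proof of the Corollary: «`2 Re Σ 1/(1 − ε^{ν}) = t`»)] -/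
theorem sum_Ico_one_div_one_sub_pow (hε : IsPrimitiveRoot ε m) (hm : 0 < m) :
    ∑ k ∈ Finset.Ico 1 m, 1 / (1 - ε ^ k) = ((m : ℂ) - 1) / 2 := by
  set f : ℕ → ℂ := fun k ↦ 1 / (1 - ε ^ k) with hf
  -- reflect `k ↦ m − k`
  have hrefl : ∑ k ∈ Finset.Ico 1 m, f k = ∑ k ∈ Finset.Ico 1 m, f (m - k) := by
    refine Finset.sum_nbij' (fun k ↦ m - k) (fun k ↦ m - k) ?_ ?_ ?_ ?_ ?_
    · intro k hk; rw [Finset.mem_Ico] at hk ⊢; omega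
    · intro k hk; rw [Finset.mem_Ico] at hk ⊢; omega
    · intro k hk; rw [Finset.mem_Ico] at hk; omega
    · intro k hk; rw [Finset.mem_Ico] at hk; omega
    · intro k hk
      rw [Finset.mem_Ico] at hk
      have hmk : m - (m - k) = k := by omega
      rw [hmk]
  have hpair : ∀ k ∈ Finset.Ico 1 m, f k + f (m - k) = 1 := by
    intro k hk
    have hk' := Finset.mem_Ico.1 hk
    have hθ1 : ε ^ k ≠ 1 := pow_ne_one_of_mem_Ico hε hk
    have hθ0 : ε ^ k ≠ 0 := pow_ne_zero _ (hε.ne_zero hm.ne')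
    have hinv : ε ^ (m - k) = (ε ^ k)⁻¹ := by
      rw [← mul_eq_one_iff_eq_inv₀ hθ0, ← pow_add, Nat.sub_add_cancel hk'.2.le, hε.pow_eq_one]
    simp only [hf, hinv]
    have h1 : (1 : ℂ) - ε ^ k ≠ 0 := sub_ne_zero.2 (Ne.symm hθ1)
    have h2 : (1 : ℂ) - (ε ^ k)⁻¹ ≠ 0 := by
      rw [sub_ne_zero, Ne, eq_comm, inv_eq_one]; exact hθ1
    field_simp
    ring
  have h2S : 2 * ∑ k ∈ Finset.Ico 1 m, f k = (m : ℂ) - 1 := by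
    rw [two_mul]
    nth_rw 2 [hrefl]
    rw [← Finset.sum_add_distrib, Finset.sum_congr rfl hpair, Finset.sum_const, Nat.card_Ico, nsmul_eq_mul,
      mul_one, Nat.cast_sub (by omega), Nat.cast_one]
  simp only [hf] at h2S
  linear_combination h2S / 2

/-- **`Σ_{k=1}^{m−1} ε^{k(α+1)}/(1 − ε^k) = α − (m − 1)/2` for `0 ≤ α ≤ m − 1`** (induction on `α`: consecutive sums
differ by `−Σ_{k=1}^{m−1} ε^{k(α+1)} = 1`; «the surviving element `l` is `o(C)·{(q−1−α)/o(C)}`», here `q = 1`).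
[cite: KopeliovichZemel2019, Theorem 6.6 (proof)] [cite: FarkasKra1992, V.2.7 («`Σ_{j=1}^{n−1} λ_{m1j} εʲ = Σ j η^j = −n/(1 − η)`»)] -/
theorem sum_Ico_pow_mul_succ_div_one_sub_pow (hε : IsPrimitiveRoot ε m) (hm : 0 < m) {α : ℕ} (hα : α < m) :
    ∑ k ∈ Finset.Ico 1 m, ε ^ (k * (α + 1)) / (1 - ε ^ k) = (α : ℂ) - ((m : ℂ) - 1) / 2 := by
  induction α with
  | zero =>
    have h1 : ∀ k ∈ Finset.Ico 1 m, ε ^ (k * (0 + 1)) / (1 - ε ^ k) = 1 / (1 - ε ^ k) - 1 := by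
      intro k hk
      have hne : (1 : ℂ) - ε ^ k ≠ 0 := sub_ne_zero.2 (Ne.symm (pow_ne_one_of_mem_Ico hε hk))
      rw [zero_add, mul_one]
      field_simp
      ring
    rw [Finset.sum_congr rfl h1, Finset.sum_sub_distrib, sum_Ico_one_div_one_sub_pow hε hm, Finset.sum_const,
      Nat.card_Ico, nsmul_eq_mul, mul_one, Nat.cast_sub (by omega), Nat.cast_zero, Nat.cast_one]
    ring
  | succ α ih =>
    have ih' := ih (by omega)
    have h1 : ∀ k ∈ Finset.Ico 1 m, ε ^ (k * (α + 1 + 1)) / (1 - ε ^ k) =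
        ε ^ (k * (α + 1)) / (1 - ε ^ k) - ε ^ (k * (α + 1)) := by
      intro k hk
      have hne : (1 : ℂ) - ε ^ k ≠ 0 := sub_ne_zero.2 (Ne.symm (pow_ne_one_of_mem_Ico hε hk))
      rw [show k * (α + 1 + 1) = k * (α + 1) + k by ring, pow_add]
      field_simp
      ring
    have hndvd : ¬ m ∣ α + 1 := fun h ↦ by
      have := Nat.le_of_dvd (by omega) h; omega
    rw [Finset.sum_congr rfl h1, Finset.sum_sub_distrib, ih', sum_Ico_pow_mul_eq_neg_one hε hm hndvd,
      Nat.cast_add, Nat.cast_one]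
    ring

/-- The `m`-th roots of unity are the powers `ε^α`, `α = 0, …, m − 1`, of a primitive root `ε`.
[cite: FarkasKra1992, V.2.4 («the eigenvalues must be of the form `εʲ` where `ε = exp(2πi/n)` with `j = 0, …, n − 1`»)] -/
theorem nthRootsFinset_eq_image_pow_of_isPrimitiveRoot (hε : IsPrimitiveRoot ε m) (hm : 0 < m) :
    Polynomial.nthRootsFinset m (1 : ℂ) = (Finset.range m).image fun α ↦ ε ^ α := by
  classical
  haveI : NeZero m := ⟨hm.ne'⟩
  ext μ
  rw [Polynomial.mem_nthRootsFinset hm, Finset.mem_image]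
  constructor
  · intro hμ
    obtain ⟨α, hα, hαμ⟩ := hε.eq_pow_of_pow_eq_one hμ
    exact ⟨α, Finset.mem_range.2 hα, hαμ⟩
  · rintro ⟨α, -, rfl⟩
    rw [pow_right_comm, hε.pow_eq_one, one_pow]

end Roots

/-! ### §2 Endomorphisms of finite order: `tr f^k = Σ_{α<m} ε^{kα} dim E_{ε^α}(f)` -/

section LinearAlgebra

variable {V : Type*} [AddCommGroup V] [Module ℂ V] [FiniteDimensional ℂ V]

open Literature.RepresentationTheory.FiniteGroups

omit [FiniteDimensional ℂ V] in
/-- **The eigenvalues of `f` with `f^m = 1` are `m`-th roots of unity**: `E_μ(f) = 0` unless `μ^m = 1`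
(«decomposes the representation space of `ρ` into eigenspaces of eigenvalues `ζ_{o(C)}^α`»).
[cite: KopeliovichZemel2019, Theorem 6.6 (preamble)] [cite: FarkasKra1992, V.2.3] -/
theorem eigenspace_eq_bot_of_pow_eq_one {f : Module.End ℂ V} {m : ℕ} (hf : f ^ m = 1) {μ : ℂ} (hμ : μ ^ m ≠ 1) :
    Module.End.eigenspace f μ = ⊥ := by
  rw [Submodule.eq_bot_iff]
  intro v hv
  have h := TracePow.pow_apply_of_mem_eigenspace f μ m hv
  rw [hf, Module.End.one_apply] at h
  have h2 : (μ ^ m - 1) • v = 0 := by rw [sub_smul, one_smul, ← h, sub_self]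
  exact (smul_eq_zero.1 h2).resolve_left (sub_ne_zero.2 hμ)

omit [FiniteDimensional ℂ V] in
/-- On `E_μ(f)` the power `f^k` acts as `μ^k`, with trace `μ^k dim E_μ`. [cite: FarkasKra1992, V.2.7 («tr `T = Σ n_j εʲ`»)] -/
theorem trace_pow_restrict_eigenspace [FiniteDimensional ℂ V] (f : Module.End ℂ V) (μ : ℂ) (k : ℕ) :
    LinearMap.trace ℂ ↥(Module.End.eigenspace f μ)
        ((f ^ k).restrict (TracePow.mapsTo_pow_eigenspace f μ k)) =
      μ ^ k * (finrank ℂ ↥(Module.End.eigenspace f μ) : ℂ) := by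
  have hres : (f ^ k).restrict (TracePow.mapsTo_pow_eigenspace f μ k) =
      (μ ^ k) • (LinearMap.id : ↥(Module.End.eigenspace f μ) →ₗ[ℂ] ↥(Module.End.eigenspace f μ)) := by
    apply LinearMap.ext
    rintro ⟨v, hv⟩
    apply Subtype.ext
    rw [LinearMap.coe_restrict_apply, LinearMap.smul_apply, LinearMap.id_apply, Submodule.coe_smul]
    exact TracePow.pow_apply_of_mem_eigenspace f μ k hv
  rw [hres, map_smul, LinearMap.trace_id, smul_eq_mul]

/-- **`tr f^k = Σ_{α=0}^{m−1} ε^{kα} · dim E_{ε^α}(f)` for `f^m = 1`** (`f` is diagonalisable with eigenvalues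
among the `ε^α`; «this multiplier is `Σ_α N_{C,α} ζ^{−αβ}`»). [cite: KopeliovichZemel2019, Theorem 6.6 (proof)]
[cite: FarkasKra1992, V.2.3 Proposition, V.2.7] -/
theorem trace_pow_eq_sum_pow_mul_finrank_eigenspace {m : ℕ} {ε : ℂ} (hε : IsPrimitiveRoot ε m) (hm : 0 < m)
    {f : Module.End ℂ V} (hf : f ^ m = 1) (k : ℕ) :
    LinearMap.trace ℂ V (f ^ k) =
      ∑ α ∈ Finset.range m, ε ^ (k * α) * (finrank ℂ ↥(Module.End.eigenspace f (ε ^ α)) : ℂ) := by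
  classical
  have hss : f.IsSemisimple := TracePow.isSemisimple_of_pow_eq_one (Nat.cast_ne_zero.2 hm.ne') hf
  have hint : DirectSum.IsInternal fun μ : ℂ ↦ Module.End.eigenspace f μ :=
    DirectSum.isInternal_submodule_of_iSupIndep_of_iSup_eq_top (Module.End.eigenspaces_iSupIndep f)
      hss.iSup_eigenspace_eq_top
  have hsub : {μ : ℂ | Module.End.eigenspace f μ ≠ ⊥} ⊆ ↑(Polynomial.nthRootsFinset m (1 : ℂ)) := fun μ hμ ↦ by
    rw [Finset.mem_coe, Polynomial.mem_nthRootsFinset hm]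
    by_contra h
    exact hμ (eigenspace_eq_bot_of_pow_eq_one hf h)
  have hfin : {μ : ℂ | Module.End.eigenspace f μ ≠ ⊥}.Finite := (Finset.finite_toSet _).subset hsub
  rw [LinearMap.trace_eq_sum_trace_restrict' hint hfin (fun μ ↦ TracePow.mapsTo_pow_eigenspace f μ k)]
  simp_rw [trace_pow_restrict_eigenspace]
  have hsubset : hfin.toFinset ⊆ Polynomial.nthRootsFinset m (1 : ℂ) := by
    rwa [← Finset.coe_subset, Set.Finite.coe_toFinset]
  have hext : ∑ μ ∈ hfin.toFinset, μ ^ k * (finrank ℂ ↥(Module.End.eigenspace f μ) : ℂ) =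
      ∑ μ ∈ Polynomial.nthRootsFinset m (1 : ℂ), μ ^ k * (finrank ℂ ↥(Module.End.eigenspace f μ) : ℂ) := by
    refine Finset.sum_subset hsubset fun μ _ hμ ↦ ?_
    rw [Set.Finite.mem_toFinset, Set.mem_setOf_eq, not_not] at hμ
    simp [hμ]
  rw [hext, nthRootsFinset_eq_image_pow_of_isPrimitiveRoot hε hm,
    Finset.sum_image fun i hi j hj h ↦ hε.pow_inj (Finset.mem_range.1 hi) (Finset.mem_range.1 hj) h]
  refine Finset.sum_congr rfl fun α _ ↦ ?_
  rw [← pow_mul, mul_comm α k]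

/-- **`Σ_{α=0}^{m−1} dim E_{ε^α}(f) = dim V`** for `f^m = 1` («the sum `Σ_α N^ρ_{C,α}` is therefore the full
dimension `d_ρ`»). [cite: KopeliovichZemel2019, Theorem 6.6 (preamble)] -/
theorem sum_finrank_eigenspace_eq_finrank {m : ℕ} {ε : ℂ} (hε : IsPrimitiveRoot ε m) (hm : 0 < m)
    {f : Module.End ℂ V} (hf : f ^ m = 1) :
    ∑ α ∈ Finset.range m, (finrank ℂ ↥(Module.End.eigenspace f (ε ^ α)) : ℂ) = finrank ℂ V := by
  have h := trace_pow_eq_sum_pow_mul_finrank_eigenspace hε hm hf 0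
  simp only [pow_zero, LinearMap.trace_one, zero_mul, one_mul] at h
  exact h.symm

end LinearAlgebra

/-! ### §3 The contribution of a fixed point -/

section FixedPoint

variable {M : Type*} [TopologicalSpace M] [ChartedSpace ℂ M] [IsManifold 𝓘(ℂ, ℂ) ω M]
  [CompactSpace M] [T2Space M] [PreconnectedSpace M] [Nonempty M] [Finite (autGroup M)]
  (G : Subgroup (autGroup M)) {V : Type*} [AddCommGroup V] [Module ℂ V] [FiniteDimensional ℂ V]
  (ρ : Representation ℂ ↥G V)

omit [CompactSpace M] [Nonempty M] in
/-- **For a generator `g` of the stabilizer `G_P`, `a_P(g)` is a primitive `|G_P|`-th root of unity** (the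
rotation number of `g` at `P`; Corollary 3.5 «`g(z) = λz`, where `λ` is a primitive `m`-th root of unity»).
[cite: Miranda1995, Chapter III Corollary 3.5] [cite: FarkasKra1992, III.7.7 Corollary] -/
theorem isPrimitiveRoot_stabDeriv_of_forall_mem_zpowers {P : M} {g : ↥G} (hg : g • P = P)
    (hgen : ∀ u : stabilizer G P, u ∈ Subgroup.zpowers (⟨g, mem_stabilizer_iff.2 hg⟩ : stabilizer G P)) :
    IsPrimitiveRoot (stabDeriv P g) (Nat.card (stabilizer G P)) :=
  isPrimitiveRoot_stabDeriv hhol_of_holomorphicSMul (t := ⟨g, mem_stabilizer_iff.2 hg⟩) hgen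

omit [CompactSpace M] [T2Space M] [PreconnectedSpace M] [Nonempty M] [Finite ↥(autGroup M)] in
/-- `a_P(g^k) = a_P(g)^k` for `g ∈ G_P`. [cite: Miranda1995, Chapter III Proposition 3.1 (proof: «`a₁` is a homomorphism»)] -/
theorem stabDeriv_pow {P : M} {g : ↥G} (hg : g • P = P) (k : ℕ) : stabDeriv P (g ^ k) = stabDeriv P g ^ k := by
  have h := map_pow (stabDerivHom hhol_of_holomorphicSMul P) (⟨g, mem_stabilizer_iff.2 hg⟩ : stabilizer G P) k
  simpa only [stabDerivHom_apply, SubmonoidClass.mk_pow] using h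

omit [IsManifold 𝓘(ℂ, ℂ) ω M] [CompactSpace M] [T2Space M] [PreconnectedSpace M] [Nonempty M] [Finite ↥(autGroup M)]
  [FiniteDimensional ℂ V] in
/-- For `g ∈ G_P`: `g^{|G_P|} = 1`, so `ρ(g)^{|G_P|} = 1`. [cite: FarkasKra1992, III.7.7 Corollary] -/
theorem map_pow_card_stabilizer_eq_one {P : M} {g : ↥G} (hg : g • P = P) :
    ρ g ^ Nat.card (stabilizer G P) = 1 := by
  have h : (⟨g, mem_stabilizer_iff.2 hg⟩ : stabilizer G P) ^ Nat.card (stabilizer G P) = 1 := pow_card_eq_one'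
  have h' : g ^ Nat.card (stabilizer G P) = 1 := by
    simpa only [SubmonoidClass.mk_pow, Subgroup.mk_eq_one] using h
  rw [← map_pow, h', map_one]

omit [CompactSpace M] [Nonempty M] in
/-- **THE CONTRIBUTION OF A FIXED POINT, indexed by the powers of a generator `g` of `G_P`** (`m = |G_P|`,
`ε = a_P(g)`, `N_α = dim Eig(ρ(g), ε^α)`):
`Σ_{k=1}^{m−1} (ε^k/(1 − ε^k))·χ_V(g^k) = Σ_{α=0}^{m−1} α·N_α − dim V·(m − 1)/2`
(«the total contribution from `P` is `Σ_l (l/o(C)) Σ_α N_{C,α} Σ_{β≠0} ζ^{β(q−1−l−α)}` … minus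
`((o(C) − 1)/2)·d_ρ`», here `q = 1` and multiplied through by `o(C)`... in the normalisation of the tree's
Eichler trace formula `tr h = 1 + Σ_P a_P(h⁻¹)/(1 − a_P(h⁻¹))`). [cite: KopeliovichZemel2019, Theorem 6.6 (proof)]
[cite: ChevalleyWeil1934Integrale] -/
theorem sum_Ico_stabDeriv_pow_div_mul_trace_eq {P : M} {g : ↥G} (hg : g • P = P)
    (hgen : ∀ u : stabilizer G P, u ∈ Subgroup.zpowers (⟨g, mem_stabilizer_iff.2 hg⟩ : stabilizer G P)) :
    ∑ k ∈ Finset.Ico 1 (Nat.card (stabilizer G P)),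
        stabDeriv P g ^ k / (1 - stabDeriv P g ^ k) * LinearMap.trace ℂ V (ρ (g ^ k)) =
      ∑ α ∈ Finset.range (Nat.card (stabilizer G P)),
          (α : ℂ) * finrank ℂ ↥(Module.End.eigenspace (ρ g) (stabDeriv P g ^ α)) -
        (finrank ℂ V : ℂ) * (((Nat.card (stabilizer G P) : ℕ) : ℂ) - 1) / 2 := by
  set m := Nat.card (stabilizer G P) with hm
  set ε := stabDeriv P g with hε'
  have hm0 : 0 < m := Nat.card_pos
  have hε : IsPrimitiveRoot ε m := isPrimitiveRoot_stabDeriv_of_forall_mem_zpowers G hg hgen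
  have hf : ρ g ^ m = 1 := map_pow_card_stabilizer_eq_one G ρ hg
  -- `χ_V(g^k) = Σ_α ε^{kα} N_α`
  have htr : ∀ k, LinearMap.trace ℂ V (ρ (g ^ k)) =
      ∑ α ∈ Finset.range m, ε ^ (k * α) * (finrank ℂ ↥(Module.End.eigenspace (ρ g) (ε ^ α)) : ℂ) := by
    intro k
    rw [map_pow]
    exact trace_pow_eq_sum_pow_mul_finrank_eigenspace hε hm0 hf k
  simp_rw [htr, Finset.mul_sum]
  rw [Finset.sum_comm]
  have hinner : ∀ α ∈ Finset.range m, ∑ k ∈ Finset.Ico 1 m,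
      ε ^ k / (1 - ε ^ k) * (ε ^ (k * α) * (finrank ℂ ↥(Module.End.eigenspace (ρ g) (ε ^ α)) : ℂ)) =
      ((α : ℂ) - ((m : ℂ) - 1) / 2) * (finrank ℂ ↥(Module.End.eigenspace (ρ g) (ε ^ α)) : ℂ) := by
    intro α hα
    rw [← sum_Ico_pow_mul_succ_div_one_sub_pow hε hm0 (Finset.mem_range.1 hα), Finset.sum_mul]
    refine Finset.sum_congr rfl fun k _ ↦ ?_
    rw [show k * (α + 1) = k + k * α by ring, pow_add]
    ring
  rw [Finset.sum_congr rfl hinner]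
  simp_rw [sub_mul, Finset.sum_sub_distrib, ← Finset.mul_sum]
  rw [sum_finrank_eigenspace_eq_finrank hε hm0 hf]
  ring

omit [IsManifold 𝓘(ℂ, ℂ) ω M] [CompactSpace M] [T2Space M] [PreconnectedSpace M] [Nonempty M] [Finite ↥(autGroup M)] in
/-- **The order of a generator of `G_P` is `m = |G_P|`.** [cite: FarkasKra1992, III.7.7 Corollary] -/
theorem orderOf_eq_card_stabilizer {P : M} {g : ↥G} (hg : g • P = P)
    (hgen : ∀ u : stabilizer G P, u ∈ Subgroup.zpowers (⟨g, mem_stabilizer_iff.2 hg⟩ : stabilizer G P)) :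
    orderOf g = Nat.card (stabilizer G P) := by
  have h1 := orderOf_eq_card_of_forall_mem_zpowers hgen
  rw [Subgroup.orderOf_mk] at h1
  simpa only [Subgroup.orderOf_coe] using h1

omit [IsManifold 𝓘(ℂ, ℂ) ω M] [CompactSpace M] [T2Space M] [PreconnectedSpace M] [Nonempty M] in
/-- **The non-trivial elements of `G_P` are `g, g², …, g^{m−1}`** for a generator `g` («the elements `τ`
over which we sum are `τ = σ^β` for `0 ≠ β ∈ ℤ/o(C)ℤ`»). [cite: KopeliovichZemel2019, Theorem 6.6 (proof)] -/
theorem filter_smul_eq_erase_one_eq_image_pow [Fintype ↥G] [DecidableEq ↥G] {P : M} {g : ↥G} (hg : g • P = P)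
    (hgen : ∀ u : stabilizer G P, u ∈ Subgroup.zpowers (⟨g, mem_stabilizer_iff.2 hg⟩ : stabilizer G P)) :
    haveI := Classical.decEq M
    (Finset.univ.filter fun h : ↥G ↦ h • P = P).erase 1 =
      (Finset.Ico 1 (Nat.card (stabilizer G P))).image fun k ↦ g ^ k := by
  classical
  have hord := orderOf_eq_card_stabilizer G hg hgen
  ext h
  simp only [Finset.mem_erase, Finset.mem_filter, Finset.mem_univ, true_and, Finset.mem_image, Finset.mem_Ico]
  constructor
  · rintro ⟨h1, hP⟩
    have hmem : (⟨h, mem_stabilizer_iff.2 hP⟩ : stabilizer G P) ∈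
        Subgroup.zpowers (⟨g, mem_stabilizer_iff.2 hg⟩ : stabilizer G P) := hgen _
    have hmem' : h ∈ Subgroup.zpowers g := by
      obtain ⟨k, hk⟩ := Subgroup.mem_zpowers_iff.1 hmem
      exact Subgroup.mem_zpowers_iff.2 ⟨k, by simpa using congrArg Subtype.val hk⟩
    rw [← mem_powers_iff_mem_zpowers, mem_powers_iff_mem_range_orderOf, Finset.mem_image] at hmem'
    obtain ⟨k, hk, rfl⟩ := hmem'
    rw [Finset.mem_range, hord] at hk
    refine ⟨k, ⟨?_, hk⟩, rfl⟩
    rcases Nat.eq_zero_or_pos k with h0 | h0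
    · exact absurd (by rw [h0, pow_zero]) h1
    · exact h0
  · rintro ⟨k, ⟨hk1, hkm⟩, rfl⟩
    refine ⟨?_, ?_⟩
    · rw [← hord] at hkm
      exact pow_ne_one_of_lt_orderOf (by omega) hkm
    · exact mem_stabilizer_iff.1 (Subgroup.pow_mem _ (mem_stabilizer_iff.2 hg) k)

omit [CompactSpace M] [Nonempty M] in
open Classical in
/-- **THE CONTRIBUTION OF A FIXED POINT `P` (sum over `G_P ∖ {1}`):
`Σ_{h ∈ G_P, h ≠ 1} (a_P(h)/(1 − a_P(h)))·χ_V(h) = Σ_{α=0}^{m−1} α·N_{P,α} − dim V·(m − 1)/2`**, `m = |G_P|`,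
`N_{P,α} = dim Eig(ρ(g), a_P(g)^α)` for any generator `g` of `G_P` (independent of `g`:
`eigenspace_eq_iInf_eigenspace_stabDeriv_pow`). [cite: KopeliovichZemel2019, Theorem 6.6 (proof: «the total
contribution from `P`»)] [cite: ChevalleyWeil1934Integrale] -/
theorem sum_stabilizer_stabDeriv_div_mul_trace_eq [Fintype ↥G] [DecidableEq ↥G] {P : M} {g : ↥G} (hg : g • P = P)
    (hgen : ∀ u : stabilizer G P, u ∈ Subgroup.zpowers (⟨g, mem_stabilizer_iff.2 hg⟩ : stabilizer G P)) :
    ∑ h ∈ (Finset.univ.filter fun h : ↥G ↦ h • P = P).erase 1,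
        stabDeriv P h / (1 - stabDeriv P h) * LinearMap.trace ℂ V (ρ h) =
      ∑ α ∈ Finset.range (Nat.card (stabilizer G P)),
          (α : ℂ) * finrank ℂ ↥(Module.End.eigenspace (ρ g) (stabDeriv P g ^ α)) -
        (finrank ℂ V : ℂ) * (((Nat.card (stabilizer G P) : ℕ) : ℂ) - 1) / 2 := by
  have hord := orderOf_eq_card_stabilizer G hg hgen
  rw [filter_smul_eq_erase_one_eq_image_pow G hg hgen, Finset.sum_image fun i hi j hj h ↦ by
    rw [Finset.mem_coe, Finset.mem_Ico, ← hord] at hi hj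
    exact pow_injOn_Iio_orderOf (Set.mem_Iio.2 hi.2) (Set.mem_Iio.2 hj.2) h]
  simp_rw [stabDeriv_pow G hg]
  exact sum_Ico_stabDeriv_pow_div_mul_trace_eq G ρ hg hgen

omit [CompactSpace M] [Nonempty M] [T2Space M] [PreconnectedSpace M] [FiniteDimensional ℂ V] in
/-- **The multiplicities `N_{P,α}` are intrinsic**: for a generator `g` of `G_P`, the `a_P(g)^α`-eigenspace of
`ρ(g)` is the `α`-isotypic part `{v : ρ(h)v = a_P(h)^α v for all h ∈ G_P}` of `V|_{G_P}` with respect to the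
faithful character `a_P : G_P → ℂ^×` («the dimensions of these spaces are independent of the choice of `σ`»).
[cite: KopeliovichZemel2019, Theorem 6.6 (preamble)] [cite: Miranda1995, Chapter III Proposition 3.1] -/
theorem eigenspace_eq_iInf_eigenspace_stabDeriv_pow {P : M} {g : ↥G} (hg : g • P = P)
    (hgen : ∀ u : stabilizer G P, u ∈ Subgroup.zpowers (⟨g, mem_stabilizer_iff.2 hg⟩ : stabilizer G P)) (α : ℕ) :
    Module.End.eigenspace (ρ g) (stabDeriv P g ^ α) =
      ⨅ h : ↥(stabilizer G P), Module.End.eigenspace (ρ (h : ↥G)) (stabDeriv P (h : ↥G) ^ α) := by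
  apply le_antisymm
  · refine le_iInf fun h ↦ fun v hv ↦ ?_
    obtain ⟨k, hk⟩ := Subgroup.mem_zpowers_iff.1 (hgen h)
    have hk' : (h : ↥G) = g ^ k := by simpa using (congrArg Subtype.val hk).symm
    have hv' := hv
    rw [Module.End.mem_eigenspace_iff] at hv ⊢
    -- reduce the integer power to a natural power using `g^{m} = 1`
    have hgfin : IsOfFinOrder g := isOfFinOrder_of_finite g
    obtain ⟨n, hn⟩ : ∃ n : ℕ, g ^ k = g ^ n := ⟨(k % (orderOf g : ℤ)).toNat, by
      rw [← zpow_natCast, Int.toNat_of_nonneg (Int.emod_nonneg _ (by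
        exact_mod_cast (hgfin.orderOf_pos).ne')), zpow_mod_orderOf]⟩
    rw [hk', hn, map_pow, Literature.RepresentationTheory.FiniteGroups.TracePow.pow_apply_of_mem_eigenspace (ρ g) _ n hv',
      stabDeriv_pow G hg,
      ← pow_mul, ← pow_mul, mul_comm]
  · exact iInf_le_of_le ⟨g, mem_stabilizer_iff.2 hg⟩ le_rfl

end FixedPoint

end RiemannSurface

end Literature.Geometry.Kaehler

end
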